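import Summits.CriticalPhenomena.PercolationContinuityZ3.Theorems.PercNearOneGluingNoHeavyQuantTwoPointPairRouteBallCrit
import Summits.CriticalPhenomena.PercolationContinuityZ3.Theorems.PercNearOneGluingNoHeavyQuantTwoPointPairRouteZ3
import HarnessLib

/-!
# QUANT lane / PAPER-2 rate track (ARM-2, gen 9): THE `φ`-PAIR ROUTE ON `ℤ³` IN NUMERALS
# — X_A(3,a,C) ⟹ `π_{p_c(ℤ³)}(n) ≤ (2^265 + 2√C)·n^{−min(a,1)/80}` and `θ(p) ≤ 2^542 (C+1) (p − p_c)^{2a′/(240−a′)}`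

builds on p205010 (kernel theorem, internal audit signed; external expert review pending)

Cell `prim-quant`, seat `prim-quant-arm-2` (constants bookkeeper), memo `RATE-CONSTANTS.md` §5.6.  Proof-only numerals file on top of
`…QuantTwoPointPairRouteBallCrit.lean` (`Quant.oneArmPolyDecayAtCritical_of_ballTwoPoint_pair_crit`: exponent `min(a,1)/(8d²+8)`, constant
`195^c·√(2C + K″_d)`) with `κ_3 = aknKappa 3 (1/6) ≤ 2^411`: `K″_3 = 5√2·27·6^{20}·40·7^{18}·κ_3 ≤ 2^{116}·2^{411} ≤ 2^{528}`
(`Quant.pairConstCrit_three_le`), `√(2C + 2^{528}) ≤ √2·√C + 2^{264}`, `195^c ≤ 6/5`, hence the registry row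
**`OneArmPolyDecayAtCritical 3 (min(a,1)/80) (2^265 + 2√C)`** (`Quant.oneArmPolyDecayAtCritical_Z3_of_ballTwoPoint_pair_crit`), the printed sentence
(`Quant.oneArm_powerLaw_Z3_of_ballTwoPoint_pair_crit`) and the Hölder companion **`ThetaHolderNearCritical 3 (2a′/(240 − a′)) (2^542 (C+1))`**
(`Quant.thetaHolder_Z3_of_ballTwoPoint_pair_crit`; exponent `2/239` at `a′ = 1`).
THE X_A FRONTIER ON `ℤ³` AFTER GEN 9 (all kernel, all conditional on the same open hypothesis, `a′ = min(a,1)`; exponent | constant | kick-in):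
packaged zone `a′/440 | 2^11√(C+1) | 2^{4840/a′}` — free ε `a′/250 | 2^44√(C+1) | 2^{11000/a′}` — Cerf zone with `φ` (ARM-1 g9) `≈ a′/100 | ≈ 2^260 | ≈ 2^{2.7·10⁴}`
— pair + bootstrap (ARM-2 g9) `a′/90 | 2^66 + 3√C | 2^{5940/a′}` — **pair + `φ` (this file) `a′/80 | 2^265 + 2√C | 2^{21200/a′}`**.
HONEST FRAMING: implications from the OPEN input X_A; class log*, display `1 − 2⁻¹⁹⁸⁶`, honest sentence UNCHANGED.
[cite: Cerf2015, Lemma 6.1, Lemma 7.1 and §10] [cite: DuminilCopinTassionEM2016, Thm. 1.1] [cite: DuminilcopinKozmaTassion2020, §7 (38)–(40)]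
[cite: HeydenreichVanDerHofstad2017, Open Problem 10.1] [cite: Newman1987BetaDelta, Theorem (β ≥ 2/δ)]
-/

noncomputable section

namespace Summit.CriticalPhenomena.PercolationContinuityZ3.Theorems.Quant

open MeasureTheory Literature.Probability.Percolation Literature.Probability.LatticeModels
open Summit.CriticalPhenomena.PercolationContinuityZ3.Theorems.SurfaceTension
open Literature.Probability.Percolation.AKN
open scoped Classical

/-- The `φ`-pair-route constant on `ℤ³`: `K″_3 = 5√2·27·6^{20}·40·7^{18}·κ_3 ≤ 2^{528}` (`κ_3 = aknKappa 3 (1/6) ≤ 2^411`; `(15/2)·27·40·6^{20}·7^{18} ≤ 2^{116}`).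
[cite: Cerf2015, Prop. 5.2] [cite: DuminilcopinKozmaTassion2020, §7 (38)] -/
theorem pairConstCrit_three_le :
    5 * Real.sqrt 2 * (((3 : ℕ) : ℝ)) ^ 3 * (2 * (((3 : ℕ) : ℝ))) ^ (6 * 3 + 2) * (4 * (((3 : ℕ) : ℝ)) ^ 2 + 4) * 7 ^ (2 * 3 ^ 2) *
        aknKappa 3 (1 / (2 * (((3 : ℕ) : ℝ)))) ≤ (2 : ℝ) ^ (528 : ℕ) := by
  have hsix : (1 / (2 * (((3 : ℕ) : ℝ))) : ℝ) = 1 / 6 := by norm_num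
  rw [hsix]
  have hκ := aknKappa_three_sixth_le
  have hκ0 : 0 ≤ aknKappa 3 (1 / 6) := le_trans (by norm_num) (three_le_aknKappa 3 _)
  have hs2 : Real.sqrt 2 ≤ 3 / 2 := by
    rw [show (3 / 2 : ℝ) = Real.sqrt ((3 / 2) ^ 2) by rw [Real.sqrt_sq (by norm_num)]]
    exact Real.sqrt_le_sqrt (by norm_num)
  have e1 : 6 * 3 + 2 = 20 := by norm_num
  have e2 : 2 * 3 ^ 2 = 18 := by norm_num
  have h1 : 5 * Real.sqrt 2 * (((3 : ℕ) : ℝ)) ^ 3 * (2 * (((3 : ℕ) : ℝ))) ^ (6 * 3 + 2) * (4 * (((3 : ℕ) : ℝ)) ^ 2 + 4) * 7 ^ (2 * 3 ^ 2) *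
        aknKappa 3 (1 / 6) = (5 * 27 * 6 ^ 20 * 40 * 7 ^ 18) * Real.sqrt 2 * aknKappa 3 (1 / 6) := by
    rw [e1, e2]; push_cast; ring
  rw [h1]
  calc (5 * 27 * 6 ^ 20 * 40 * 7 ^ 18 : ℝ) * Real.sqrt 2 * aknKappa 3 (1 / 6)
      ≤ (5 * 27 * 6 ^ 20 * 40 * 7 ^ 18) * (3 / 2) * (2 : ℝ) ^ 411 :=
        mul_le_mul (mul_le_mul_of_nonneg_left hs2 (by norm_num)) hκ hκ0 (by positivity)
    _ ≤ (2 : ℝ) ^ (117 : ℕ) * (2 : ℝ) ^ 411 := mul_le_mul_of_nonneg_right (by norm_num) (by positivity)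
    _ = (2 : ℝ) ^ (528 : ℕ) := by rw [← pow_add]

/-- **X_A ⟹ (T1) ON `ℤ³`, `φ`-PAIR ROUTE (registry form)**: `Σ_{x ∈ Λ_R} τ_{p_c}(0,x) ≤ C R^{3−a}` for all `R ≥ 1` (`a > 0`) ⟹
`OneArmPolyDecayAtCritical 3 (min(a,1)/80) (2^265 + 2√C)` — the lane's best conditional exponent for X_A on `ℤ³`.
builds on p205010 (kernel theorem, internal audit signed; external expert review pending).
[cite: Cerf2015, Lemma 6.1, Lemma 7.1 and §10] [cite: DuminilCopinTassionEM2016, Thm. 1.1] [cite: HeydenreichVanDerHofstad2017, Open Problem 10.1] -/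
theorem oneArmPolyDecayAtCritical_Z3_of_ballTwoPoint_pair_crit {a C : ℝ} (ha0 : 0 < a)
    (hS : ∀ R : ℕ, 1 ≤ R → ∑ x ∈ box 3 R, tau 3 (criticalProbI 3) 0 x ≤ C * (R : ℝ) ^ (((3 : ℕ) : ℝ) - a)) :
    OneArmPolyDecayAtCritical 3 (min a 1 / 80) ((2 : ℝ) ^ (265 : ℕ) + 2 * Real.sqrt C) := by
  have hC1 : 1 ≤ C := one_le_const_of_ballTwoPoint (criticalProbI 3) hS
  have hC0 : 0 ≤ C := by linarith
  have h := oneArmPolyDecayAtCritical_of_ballTwoPoint_pair_crit (d := 3) (by norm_num) ha0 hS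
  have h80 : (8 * (((3 : ℕ) : ℝ)) ^ 2 + 8) = 80 := by norm_num
  have hexp : min a 1 / (8 * (((3 : ℕ) : ℝ)) ^ 2 + 8) = min a 1 / 80 := by rw [h80]
  rw [hexp] at h
  refine oneArmPolyDecayAtCritical_const_mono h ?_
  have hK := pairConstCrit_three_le
  have hc0 : 0 ≤ min a 1 / 80 := by have := lt_min ha0 one_pos; positivity
  have hc1 : min a 1 / 80 ≤ 1 / 40 := by have := min_le_right a 1; linarith
  have h195 := rpow_195_le hc0 hc1
  have hsC : 0 ≤ Real.sqrt C := Real.sqrt_nonneg C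
  set K : ℝ := 5 * Real.sqrt 2 * (((3 : ℕ) : ℝ)) ^ 3 * (2 * (((3 : ℕ) : ℝ))) ^ (6 * 3 + 2) * (4 * (((3 : ℕ) : ℝ)) ^ 2 + 4) *
      7 ^ (2 * 3 ^ 2) * aknKappa 3 (1 / (2 * (((3 : ℕ) : ℝ)))) with hKdef
  have hK0 : 0 ≤ K := by rw [hKdef]; exact mul_nonneg (by positivity) (le_trans (by norm_num) (three_le_aknKappa 3 _))
  -- `√(2C + K) ≤ √2 √C + 2^264`
  have hsqrt : Real.sqrt (2 * C + K) ≤ Real.sqrt 2 * Real.sqrt C + (2 : ℝ) ^ (264 : ℕ) := by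
    have h1 : Real.sqrt (2 * C + K) ≤ Real.sqrt (2 * C) + Real.sqrt K := by
      rw [Real.sqrt_le_left (by positivity)]
      have h2 : Real.sqrt (2 * C) ^ 2 = 2 * C := Real.sq_sqrt (by positivity)
      have h3 : Real.sqrt K ^ 2 = K := Real.sq_sqrt hK0
      nlinarith [Real.sqrt_nonneg (2 * C), Real.sqrt_nonneg K]
    have h4 : Real.sqrt (2 * C) = Real.sqrt 2 * Real.sqrt C := Real.sqrt_mul (by norm_num) C
    have h5 : Real.sqrt K ≤ (2 : ℝ) ^ (264 : ℕ) := by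
      rw [show ((2 : ℝ) ^ (264 : ℕ)) = Real.sqrt (((2 : ℝ) ^ (264 : ℕ)) ^ 2) by rw [Real.sqrt_sq (by positivity)]]
      refine Real.sqrt_le_sqrt (hK.trans ?_)
      rw [← pow_mul]
    rw [← h4]
    exact h1.trans (add_le_add le_rfl h5)
  have hs2 : Real.sqrt 2 ≤ 3 / 2 := by
    rw [show (3 / 2 : ℝ) = Real.sqrt ((3 / 2) ^ 2) by rw [Real.sqrt_sq (by norm_num)]]
    exact Real.sqrt_le_sqrt (by norm_num)
  have h0 : 0 ≤ (195 : ℝ) ^ (min a 1 / 80) := Real.rpow_nonneg (by norm_num) _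
  have hs0 : 0 ≤ Real.sqrt (2 * C + K) := Real.sqrt_nonneg _
  have h265 : (2 : ℝ) ^ (265 : ℕ) = 2 * (2 : ℝ) ^ (264 : ℕ) := by rw [← pow_succ']
  have hA0 : (0 : ℝ) ≤ (2 : ℝ) ^ (264 : ℕ) := by positivity
  have hss : Real.sqrt 2 * Real.sqrt C ≤ 3 / 2 * Real.sqrt C := mul_le_mul_of_nonneg_right hs2 hsC
  rw [h265]
  generalize hA : (2 : ℝ) ^ (264 : ℕ) = A at hsqrt hA0 ⊢
  have hstep : (195 : ℝ) ^ (min a 1 / 80) * Real.sqrt (2 * C + K) ≤ (6 / 5) * (Real.sqrt 2 * Real.sqrt C + A) :=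
    mul_le_mul h195 hsqrt hs0 (by norm_num)
  -- (hypotheses with powers above `exponentiation.threshold` are cleared before `linarith`)
  clear hK h265 hA hKdef h
  linarith

/-- **THE PRINTED CONDITIONAL POWER LAW ON `ℤ³`, `φ`-PAIR ROUTE.**  IF `Σ_{x ∈ Λ_R} P_{p_c}(0 ↔ x) ≤ C R^{3−a}` for all `R ≥ 1` with `a > 0`, THEN for
every `n ≥ 1`:  **`π_{p_c(ℤ³)}(n) ≤ (2^265 + 2√C) · n^{−min(a,1)/80}`** (exponent `a′/80`: the lane's best X_A row; constant `2^265` against `2^66`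
for the exponent `a′/90` of the bootstrap pair route).
builds on p205010 (kernel theorem, internal audit signed; external expert review pending).
[cite: Cerf2015, Lemma 6.1, Lemma 7.1 and §10] [cite: DuminilCopinTassionEM2016, Thm. 1.1] [cite: HeydenreichVanDerHofstad2017, Open Problem 10.1] -/
theorem oneArm_powerLaw_Z3_of_ballTwoPoint_pair_crit {a C : ℝ} (ha0 : 0 < a)
    (hS : ∀ R : ℕ, 1 ≤ R → ∑ x ∈ box 3 R,
      (bondPercolation (zdGraph 3) (criticalProbI 3)).real (openConn 0 x) ≤ C * (R : ℝ) ^ ((3 : ℝ) - a)) :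
    ∀ n : ℕ, 1 ≤ n → oneArmProb 3 (criticalProbI 3) n ≤ ((2 : ℝ) ^ (265 : ℕ) + 2 * Real.sqrt C) * (n : ℝ) ^ (-(min a 1 / 80)) := by
  have h3 : (((3 : ℕ) : ℝ)) = (3 : ℝ) := by norm_num
  have hS' : ∀ R : ℕ, 1 ≤ R → ∑ x ∈ box 3 R, tau 3 (criticalProbI 3) 0 x ≤ C * (R : ℝ) ^ (((3 : ℕ) : ℝ) - a) := by
    intro R hR; rw [h3]; exact hS R hR
  exact fun n hn => oneArmPolyDecayAtCritical_Z3_of_ballTwoPoint_pair_crit ha0 hS' n hn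

/-- **(T2) OF THE `φ`-PAIR ROUTE ON `ℤ³`**: X_A(3,a,C) ⟹ `ThetaHolderNearCritical 3 (2a′/(240 − a′)) (2^542 (C+1))`, `a′ = min(a,1)`, i.e.
**`θ(p) ≤ 2^542 (C+1) (p − p_c)^{2a′/(240−a′)}`** for `p ≥ p_c(ℤ³)` (the lane's Newman/two-box transfer at `c = a′/80 ≤ 1/4`; exponent `2/239` at
`a′ = 1` — the lane's best conditional Hölder exponent for X_A).
builds on p205010 (kernel theorem, internal audit signed; external expert review pending).
[cite: Newman1987BetaDelta, Theorem (β ≥ 2/δ)] [cite: Cerf2015, Lemma 7.1 and §10] [cite: DuminilCopinTassionEM2016, Thm. 1.1] -/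
theorem thetaHolder_Z3_of_ballTwoPoint_pair_crit {a C : ℝ} (ha0 : 0 < a)
    (hS : ∀ R : ℕ, 1 ≤ R → ∑ x ∈ box 3 R, tau 3 (criticalProbI 3) 0 x ≤ C * (R : ℝ) ^ (((3 : ℕ) : ℝ) - a)) :
    ThetaHolderNearCritical 3 (2 * min a 1 / (240 - min a 1)) ((2 : ℝ) ^ (542 : ℕ) * (C + 1)) := by
  have hC1 : 1 ≤ C := one_le_const_of_ballTwoPoint (criticalProbI 3) hS
  have hC0 : 0 ≤ C := by linarith
  have h1 := oneArmPolyDecayAtCritical_Z3_of_ballTwoPoint_pair_crit ha0 hS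
  have hc0 : 0 < min a 1 / 80 := by have := lt_min ha0 one_pos; positivity
  have hc : min a 1 / 80 ≤ 1 / 4 := by have := min_le_right a 1; linarith
  have hC' : 0 ≤ (2 : ℝ) ^ (265 : ℕ) + 2 * Real.sqrt C := by positivity
  have h2 := thetaHolder_Z3_of_oneArmPolyDecay_numeral' hc0 hc hC' h1
  have hexp : 2 * (min a 1 / 80) / (((3 : ℕ) : ℝ) - min a 1 / 80) = 2 * min a 1 / (240 - min a 1) := by
    have key : (((3 : ℕ) : ℝ) - min a 1 / 80) = (240 - min a 1) / 80 := by push_cast; ring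
    rw [key, div_div_eq_mul_div]
    congr 1; ring
  rw [hexp] at h2
  refine thetaHolderNearCritical_const_mono h2 ?_
  -- `16(2C′ + 125 + 108C′²) + 2 ≤ 2^542 (C+1)` with `C′ = A + 2s`, `A = 2^265`, `s = √C`, `s² = C`, `2^542 = 2^12 A²`
  have hs := Real.sq_sqrt hC0
  set s := Real.sqrt C with hsdef
  have hsC : 0 ≤ s := Real.sqrt_nonneg C
  have h542 : (2 : ℝ) ^ (542 : ℕ) = (2 : ℝ) ^ (12 : ℕ) * ((2 : ℝ) ^ (265 : ℕ)) ^ 2 := by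
    rw [← pow_mul, ← pow_add]
  rw [h542, ← hs]
  have h4le : (2 : ℝ) ^ (4 : ℕ) ≤ (2 : ℝ) ^ (265 : ℕ) := pow_le_pow_right₀ (by norm_num) (by norm_num)
  have h12 : (2 : ℝ) ^ (12 : ℕ) = 4096 := by norm_num
  rw [h12]
  generalize hA : (2 : ℝ) ^ (265 : ℕ) = A at h4le ⊢
  -- (hypotheses with powers above `exponentiation.threshold` are cleared before `linarith`)
  clear h1 h2 hC' h542 hA
  have hA16 : 16 ≤ A := by
    calc (16 : ℝ) = (2 : ℝ) ^ (4 : ℕ) := by norm_num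
      _ ≤ A := h4le
  have hApos : 0 ≤ A := by linarith
  have hA2 : 256 ≤ A ^ 2 := by
    calc (256 : ℝ) = 16 * 16 := by norm_num
      _ ≤ A * A := mul_le_mul hA16 hA16 (by norm_num) hApos
      _ = A ^ 2 := (sq A).symm
  have hAs : 4 * A * s ≤ A ^ 2 + 4 * s ^ 2 := by
    have e : A ^ 2 + 4 * s ^ 2 - 4 * A * s = (A - 2 * s) ^ 2 := by ring
    linarith [sq_nonneg (A - 2 * s), e]
  have hB : 4 * s ≤ 2 * s ^ 2 + 2 := by
    have e : 2 * s ^ 2 + 2 - 4 * s = 2 * (s - 1) ^ 2 := by ring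
    linarith [sq_nonneg (s - 1), e]
  have hP : 256 * s ^ 2 ≤ A ^ 2 * s ^ 2 := mul_le_mul_of_nonneg_right hA2 (sq_nonneg s)
  have hQ : 32 * A ≤ 2 * A ^ 2 := by
    have h' : 16 * A ≤ A ^ 2 := by rw [sq]; exact mul_le_mul_of_nonneg_right hA16 hApos
    linarith
  have hs2 : 0 ≤ s ^ 2 := sq_nonneg s
  have hexpand : 16 * (2 * (A + 2 * s) + 125 + 108 * (A + 2 * s) ^ 2) + 2 =
      1728 * A ^ 2 + 6912 * (A * s) + 6912 * s ^ 2 + 32 * A + 64 * s + 2002 := by ring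
  have hrhs : 4096 * A ^ 2 * (s ^ 2 + 1) = 4096 * (A ^ 2 * s ^ 2) + 4096 * A ^ 2 := by ring
  rw [hexpand, hrhs]
  have hAs' : 6912 * (A * s) ≤ 1728 * A ^ 2 + 6912 * s ^ 2 := by
    have : A * s = (4 * A * s) / 4 := by ring
    linarith [hAs]
  linarith [hAs', hB, hP, hQ, hA2, hs2]

end Summit.CriticalPhenomena.PercolationContinuityZ3.Theorems.Quant

end
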